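import Literature.Probability.Percolation.ArmSeparationOutSepFour
import Literature.Probability.Percolation.ArmSeparationOutMoveFour
import Literature.Probability.Percolation.ArmSeparationExtFourArmQ
import Literature.Probability.Percolation.LocallyMonotoneFKG
import HarnessLib

/-!
# The four-arm outer landing step at density `p`: moves, Lemma 13, and the sum over slots

Topic `Literature/Probability/Percolation`; family `crit-perc` / near-critical percolation on `𝕋`.
A brick of the near-critical arm-separation theorem for four arms of alternating colours
(P. Nolin, *Near-critical percolation in two dimensions*, EJP 13 (2008), Thm. 11 for `j = 4`,
`σ = BWBW` [arXiv 0711.4948: Thm. 10]; H. Kesten, CMP 109 (1987), Lemmas 4–6), landing step of the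
external extremities at an arbitrary density `p` (Nolin 2008, §4.4, p. 12, with Prop. 12 (i)/(iii)
and Lemma 13 [arXiv Prop. 11, Lemma 12], "for any product measure `P̂`"). The four-arm analogue of
the landing half of the tree's `ArmSeparationOutLanding.lean`, for the slots of
`ArmSeparationOutSlotsFour.lean` (supports disjoint by `ArmSeparationOutSepFour.lean`):

* `Tube.le_real_event_at`, `Tube.pow_le_real_eventAll_at`, `real_ocorrEvent4_ge_at` — RSW–Harris
  lower bounds for tubes, chains and the corridor at any density `q`, from crossing hypotheses at `q`
  for all short sides up to a cap (to be discharged below `L(p)`);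
* `Slot4.move` — **the move**: for a valid rung, a slot in range with the routing predicate, on the
  four arm events and the four corridor events the configuration lies in `extFourArmQ n (4M)` (the
  tree's `out_landing_move`, generalised to arbitrary middle target rows and to the top side in
  `ArmSeparationOutMoveFour.lean`, applied in the four reading configurations; the entry piece and
  the exit run are on the arc by the routing predicate);
* `Slot4.real_arms_le` — **Nolin's Lemma 13 per slot**: `P_p(⋂ₑ armE e) · q⁴ ≤ P_p(extFourArmQ n (4M))`
  with `q = c_F c^(B+3)` the corridor bound at `p` and at `1 - p` (`triSitePercolation_locallyMonotone_fkg`,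
  increasing events = the two open arms and their corridors, decreasing = the two closed ones);
* `real_biUnion_arms_le` — the sum over any finite set of routed slots in range.

The covering of the output event `OutMidTiny4` of the outer step by routed slots (the choice of target
rows, cut, levels and arcs: `ArmSeparationLanes.lean`) is the next file. Everything here is proved;
no named facts are introduced.

## References

* P. Nolin, Near-critical percolation in two dimensions, *Electron. J. Probab.* 13 (2008), §4.3
  Prop. 12, Lemma 13, §4.4 (arXiv 0711.4948: Prop. 11, Lemma 12, proof of Thm. 10, p. 12) [Nolin2008].
* H. Kesten, Scaling relations for 2D-percolation, *Comm. Math. Phys.* 109 (1987), Lemma 2, §2 [Kesten1987].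

Tree: `out_landing_move_row`, `out_landing_move_two`, `Tube.swap` (`ArmSeparationOutMoveFour.lean`);
`TrapFencedArm.transport`; `ospokeMeets_pieceTube`, `ringTube_piecePos`, `pieceTube`, `halfTube_hside`,
`mem_vchunks`, `exists_pos_of_mem_vchunks`; `ringTube_mem_arc_of_inArc`; `extFourArmQ`,
`frameConfig_two_three` (`ArmSeparationExtFourArmQ.lean`); `triSitePercolation_locallyMonotone_fkg`,
`sitePercolation_harris'`; `real_preimage_psiCfg`, `determinedBy_corrE/armE`, `disjoint_privE`,
`disjoint_osharedFin_privE`; `triSitePercolation_real_triHCross/triVCross`, `triLRCrossingProb_anti_width`.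
-/

noncomputable section

open Set MeasureTheory

namespace Literature.Probability.Percolation

open LatticeModels Tube

/-! ### RSW–Harris for tubes at any density -/

namespace Tube

/-- The short side of a tube: its height if crossed horizontally, its width otherwise. [folklore] -/
def short (T : Tube) : ℕ := bif T.horiz then T.h else T.w

/-- **RSW for one tube at density `q`**: if `c ≤ P_q(long-way crossing of [0, ρ n] × [0, n])` for all
`1 ≤ n ≤ Ncap`, a tube of aspect ratio at most `ρ` and short side `≤ Ncap` is crossed with probability at
least `c`. [cite: Nolin2008, §4.3 Prop. 12 (proof) (arXiv 0711.4948: Prop. 11)] -/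
theorem le_real_event_at (q : unitInterval) {ρ Ncap : ℕ} {c : ℝ} {T : Tube}
    (hrsw : ∀ n : ℕ, 1 ≤ ⌊(ρ : ℝ) * n⌋₊ → n ≤ Ncap → c ≤ triLRCrossingProb q ⌊(ρ : ℝ) * n⌋₊ n) (hρ : 1 ≤ ρ)
    (hT : T.AspectLE ρ) (hsz : T.short ≤ Ncap) : c ≤ (triSitePercolation q).real T.event := by
  have hfl : ∀ n : ℕ, ⌊(ρ : ℝ) * (n : ℕ)⌋₊ = ρ * n := fun n => by
    have : (ρ : ℝ) * (n : ℕ) = ((ρ * n : ℕ) : ℝ) := by push_cast; ring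
    rw [this, Nat.floor_natCast]
  have hcw : ∀ L n : ℕ, 1 ≤ n → n ≤ Ncap → L ≤ ρ * n → c ≤ triLRCrossingProb q L n := fun L n hn hcap hL => by
    have h := hrsw n (by rw [hfl]; exact le_trans hn (Nat.le_mul_of_pos_left n hρ)) hcap
    rw [hfl] at h
    exact h.trans (triLRCrossingProb_anti_width q hL n)
  unfold event; unfold AspectLE at hT; unfold short at hsz
  cases hh : T.horiz
  · rw [hh] at hT hsz; simp only [cond_false] at hT hsz ⊢
    rw [triSitePercolation_real_triVCross]; exact hcw _ _ hT.2 hsz hT.1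
  · rw [hh] at hT hsz; simp only [cond_true] at hT hsz ⊢
    rw [triSitePercolation_real_triHCross]; exact hcw _ _ hT.2 hsz hT.1

/-- **RSW–Harris for a chain of tubes at density `q`**: `P_q(eventAll L) ≥ c ^ |L|` when every tube of
`L` has aspect ratio at most `ρ` and short side `≤ Ncap` (`0 ≤ c`). [cite: Nolin2008, §4.3 Prop. 12 (proof) (arXiv 0711.4948: Prop. 11)] -/
theorem pow_le_real_eventAll_at (q : unitInterval) {ρ Ncap : ℕ} {c : ℝ}
    (hrsw : ∀ n : ℕ, 1 ≤ ⌊(ρ : ℝ) * n⌋₊ → n ≤ Ncap → c ≤ triLRCrossingProb q ⌊(ρ : ℝ) * n⌋₊ n) (hρ : 1 ≤ ρ) (hc : 0 ≤ c) :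
    ∀ L : List Tube, (∀ T ∈ L, T.AspectLE ρ ∧ T.short ≤ Ncap) → c ^ L.length ≤ (triSitePercolation q).real (eventAll L)
  | [], _ => by
    have : eventAll [] = Set.univ := by ext ω; simp [eventAll]
    rw [this, List.length_nil, pow_zero]
    exact (probReal_univ (μ := triSitePercolation q)).symm.le
  | T :: L, hasp => by
    have ih := pow_le_real_eventAll_at q hrsw hρ hc L fun T' hT' => hasp T' (List.mem_cons_of_mem _ hT')
    have hT := le_real_event_at q hrsw hρ (hasp T List.mem_cons_self).1 (hasp T List.mem_cons_self).2
    have hsplit : eventAll (T :: L) = T.event ∩ eventAll L := by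
      ext ω; simp [eventAll]
    have hH := sitePercolation_harris' q T.determinedBy_event (determinedBy_eventAll L) T.isUpperSet_event
      (isUpperSet_eventAll L)
    unfold triSitePercolation at ih hT ⊢
    rw [hsplit, List.length_cons, pow_succ, mul_comm]
    exact (mul_le_mul hT ih (pow_nonneg hc _) measureReal_nonneg).trans hH

end Tube

/-- The identity frame does nothing. [folklore] -/
theorem frameConfig_zero (χ : SiteConfig (Site 2)) : frameConfig 0 χ = χ := by
  ext v; rw [mem_frameConfig]; rfl

/-- The short side of every tube of the thin ring is `2e`. [folklore] -/
theorem short_ringTube (r e s g : ℕ) : (ringTube r e s g).short = 2 * e := by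
  unfold ringTube halfTube
  split_ifs <;> rfl

/-- The short side of a tube of the thin ring is `2e` (`1 ≤ r / s`). [folklore] -/
theorem short_of_mem_thinRing {r e s : ℕ} (hr : 1 ≤ r / s) {T : Tube} (hT : T ∈ thinRing r e s) : T.short = 2 * e := by
  obtain ⟨g, -, rfl⟩ := exists_eq_ringTube_of_mem hr hT
  exact short_ringTube r e s g

/-- Exit-run arithmetic: `(d + 1) s ≤ N'/64 + 4 s` and `N'/64 + 2 s ≤ d s` for `d = N'/64/s + 3` (`1 ≤ s`). [folklore] -/
theorem OParams.d_mul_facts (P : OParams) (hs : 1 ≤ P.s) : (P.d + 1) * P.s ≤ P.N' / 64 + 4 * P.s ∧ P.N' / 64 + 2 * P.s ≤ P.d * P.s := by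
  unfold OParams.d
  have h1 := Nat.div_mul_le_self (P.N' / 64) P.s
  have h2 := Nat.lt_div_mul_add (a := P.N' / 64) hs
  constructor <;> nlinarith

/-- **The four-arm outer corridor has probability at least `c_F c^(B+3)` at density `q`.** As the
tree's `real_ocorrEvent_ge`, at any density, for either base side, with the crossing hypothesis capped
at short sides `≤ Ncap` (`2ε, 2e, N'/64, N'/16 - 1 ≤ Ncap`). [cite: Nolin2008, §4.3 Prop. 12 (proof) (arXiv 0711.4948: Prop. 11)] -/
theorem real_ocorrEvent4_ge_at (q : unitInterval) {cF c : ℝ} {ρ Ncap : ℕ}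
    (hF : ∀ (z : Site 2) (k : ℕ), 1 ≤ k → k ≤ Ncap → cF ≤ (triSitePercolation q).real (triFrameAt z k))
    (hrsw : ∀ n : ℕ, 1 ≤ ⌊(ρ : ℝ) * n⌋₊ → n ≤ Ncap → c ≤ triLRCrossingProb q ⌊(ρ : ℝ) * n⌋₊ n) (hρ : 4 ≤ ρ) (hc : 0 ≤ c)
    {i M k : ℕ} (hk : 2 ≤ k) (hkcap : k / 2 ≤ Ncap) {T₀ : ℤ} {w L ε r e s a len B bs : ℕ} {t : ℤ} {W N' : ℕ}
    (hε : 1 ≤ ε) (hεcap : 2 * ε ≤ Ncap) (hsp : L + k / 4 ≤ ρ * (2 * ε)) (he : 1 ≤ e) (hecap : 2 * e ≤ Ncap) (hse : s + 2 * e ≤ 4 * (2 * e))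
    (hrs : 1 ≤ r / s)
    (hn : 1 ≤ N' / 64) (hncap : N' / 64 ≤ Ncap) (hW : W ≤ ρ * (N' / 64)) (hV : 2 * (N' / 64) ≤ ρ * (N' / 16 - 1)) (hV' : 1 ≤ N' / 16 - 1)
    (hVcap : N' / 16 - 1 ≤ Ncap) (hlen : (arc (thinRing r e s) a len).length ≤ B) :
    cF * c ^ (B + 3) ≤ (triSitePercolation q).real (ocorrEvent4 i M k T₀ w L ε r e s a len bs t W N') := by
  have hρ1 : 1 ≤ ρ := le_trans (by norm_num) hρ
  have hc1 : c ≤ 1 := by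
    have h := hrsw 1 (by rw [Nat.cast_one, mul_one, Nat.floor_natCast]; exact hρ1) (le_trans hε (by omega))
    exact h.trans measureReal_le_one
  -- the five events, their supports and monotonicity
  set E1 := obcnEvent i M k T₀ w with hE1
  set E2 := ospokeEvent i M k T₀ w L ε with hE2
  set E3 := eventAll (arc (thinRing r e s) a len) with hE3
  set E4 : Set (SiteConfig (Site 2)) := {χ | frameConfig bs χ ∈ triHCross ((r : ℤ) - 2 * e) t W (N' / 64)} with hE4
  set E5 : Set (SiteConfig (Site 2)) := {χ | frameConfig bs χ ∈ otgtV N' t} with hE5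
  have d1 : DeterminedBy E1 ↑((triSqAnnulusFinset (obcnCentre M k T₀ w) (k / 2) (2 * (k / 2))).image (frameIso i)) := by
    rw [Finset.coe_image]; exact determinedBy_preimage_frameConfig i (determinedBy_triFrameAt _ _)
  have d2 : DeterminedBy E2 ↑((ospokeTube M k T₀ w L ε).sites.image (frameIso i)) := by
    rw [Finset.coe_image, coe_sites]; exact determinedBy_ospokeEvent i M k T₀ w L ε
  have d3 : DeterminedBy E3 ↑(sitesAll (arc (thinRing r e s) a len)) := determinedBy_eventAll _
  have d4 : DeterminedBy E4 ↑((triStripFinset ((r : ℤ) - 2 * e) t W (N' / 64)).image (frameIso bs)) := by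
    rw [Finset.coe_image]; exact determinedBy_preimage_frameConfig bs (determinedBy_triHCross _ _ _ _)
  have d5 : DeterminedBy E5 ↑((triStripFinset ((N' : ℤ) + 1) (t - (N' / 64 : ℕ)) (N' / 16 - 1) (2 * (N' / 64))).image (frameIso bs)) := by
    rw [Finset.coe_image]
    exact determinedBy_preimage_frameConfig bs (determinedBy_triVCross _ _ _ _)
  have u1 : IsUpperSet E1 := isUpperSet_obcnEvent i M k T₀ w
  have u2 : IsUpperSet E2 := isUpperSet_ospokeEvent i M k T₀ w L ε
  have u3 : IsUpperSet E3 := isUpperSet_eventAll _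
  have u4 : IsUpperSet E4 := isUpperSet_preimage_frameConfig bs (isUpperSet_triHCross _ _ _ _)
  have u5 : IsUpperSet E5 := isUpperSet_preimage_frameConfig bs (isUpperSet_triVCross _ _ _ _)
  -- the five probabilities
  have p1 : cF ≤ (triSitePercolation q).real E1 := by
    rw [hE1, obcnEvent, show {χ | frameConfig i χ ∈ triFrameAt (obcnCentre M k T₀ w) (k / 2)} =
      frameConfig i ⁻¹' triFrameAt (obcnCentre M k T₀ w) (k / 2) from rfl, real_preimage_frameConfig]
    exact hF _ _ (by omega) hkcap
  have p2 : c ≤ (triSitePercolation q).real E2 := by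
    rw [hE2, ospokeEvent, show {χ | frameConfig i χ ∈ (ospokeTube M k T₀ w L ε).event} = frameConfig i ⁻¹' (ospokeTube M k T₀ w L ε).event
      from rfl, real_preimage_frameConfig]
    refine Tube.le_real_event_at q hrsw hρ1 ?_ ?_
    · simp only [Tube.AspectLE, ospokeTube, cond_true]; exact ⟨hsp, by omega⟩
    · simp only [Tube.short, ospokeTube, cond_true]; exact hεcap
  have p3 : c ^ B ≤ (triSitePercolation q).real E3 := by
    refine le_trans (pow_le_pow_of_le_one hc hc1 hlen) ?_
    refine Tube.pow_le_real_eventAll_at q hrsw hρ1 hc _ fun T hT => ⟨?_, ?_⟩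
    · exact (aspectLE_of_mem_thinRing he hse (mem_of_mem_arc hT)).mono hρ
    · rw [short_of_mem_thinRing hrs (mem_of_mem_arc hT)]; exact hecap
  have p4 : c ≤ (triSitePercolation q).real E4 := by
    rw [hE4, show {χ | frameConfig bs χ ∈ triHCross ((r : ℤ) - 2 * e) t W (N' / 64)} =
      frameConfig bs ⁻¹' (⟨(r : ℤ) - 2 * e, t, W, N' / 64, true⟩ : Tube).event from rfl, real_preimage_frameConfig]
    refine Tube.le_real_event_at q hrsw hρ1 ?_ ?_
    · simp only [Tube.AspectLE, cond_true]; exact ⟨hW, hn⟩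
    · simp only [Tube.short, cond_true]; exact hncap
  have p5 : c ≤ (triSitePercolation q).real E5 := by
    rw [hE5, show {χ | frameConfig bs χ ∈ otgtV N' t} =
      frameConfig bs ⁻¹' (⟨(N' : ℤ) + 1, t - (N' / 64 : ℕ), N' / 16 - 1, 2 * (N' / 64), false⟩ : Tube).event from rfl, real_preimage_frameConfig]
    refine Tube.le_real_event_at q hrsw hρ1 ?_ ?_
    · simp only [Tube.AspectLE, cond_false]; exact ⟨hV, hV'⟩
    · simp only [Tube.short, cond_false]; exact hVcap
  -- Harris, four times
  have h12 := sitePercolation_harris' q d1 d2 u1 u2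
  have d12 : DeterminedBy (E1 ∩ E2) ↑((triSqAnnulusFinset (obcnCentre M k T₀ w) (k / 2) (2 * (k / 2))).image (frameIso i) ∪
      (ospokeTube M k T₀ w L ε).sites.image (frameIso i)) := by
    rw [Finset.coe_union]; exact (d1.mono subset_union_left).inter (d2.mono subset_union_right)
  have h123 := sitePercolation_harris' q d12 d3 (u1.inter u2) u3
  have d123 : DeterminedBy (E1 ∩ E2 ∩ E3) ↑(((triSqAnnulusFinset (obcnCentre M k T₀ w) (k / 2) (2 * (k / 2))).image (frameIso i) ∪
      (ospokeTube M k T₀ w L ε).sites.image (frameIso i)) ∪ sitesAll (arc (thinRing r e s) a len)) := by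
    rw [Finset.coe_union]; exact (d12.mono subset_union_left).inter (d3.mono subset_union_right)
  have h1234 := sitePercolation_harris' q d123 d4 ((u1.inter u2).inter u3) u4
  have d1234 : DeterminedBy (E1 ∩ E2 ∩ E3 ∩ E4)
      ↑((((triSqAnnulusFinset (obcnCentre M k T₀ w) (k / 2) (2 * (k / 2))).image (frameIso i) ∪
      (ospokeTube M k T₀ w L ε).sites.image (frameIso i)) ∪ sitesAll (arc (thinRing r e s) a len)) ∪
      (triStripFinset ((r : ℤ) - 2 * e) t W (N' / 64)).image (frameIso bs)) := by
    rw [Finset.coe_union]; exact (d123.mono subset_union_left).inter (d4.mono subset_union_right)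
  have h12345 := sitePercolation_harris' q d1234 d5 (((u1.inter u2).inter u3).inter u4) u5
  unfold triSitePercolation at p1 p2 p3 p4 p5 ⊢
  unfold ocorrEvent4
  rw [← hE1, ← hE2, ← hE3]
  change cF * c ^ (B + 3) ≤ (sitePercolation (Site 2) q).real (E1 ∩ E2 ∩ E3 ∩ E4 ∩ E5)
  calc cF * c ^ (B + 3) = cF * c * c ^ B * c * c := by ring
    _ ≤ (sitePercolation (Site 2) q).real E1 * (sitePercolation (Site 2) q).real E2 *
        (sitePercolation (Site 2) q).real E3 * (sitePercolation (Site 2) q).real E4 * (sitePercolation (Site 2) q).real E5 := by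
      gcongr
    _ ≤ (sitePercolation (Site 2) q).real (E1 ∩ E2 ∩ E3 ∩ E4 ∩ E5) := by
      calc _ ≤ (sitePercolation (Site 2) q).real (E1 ∩ E2) * (sitePercolation (Site 2) q).real E3 *
            (sitePercolation (Site 2) q).real E4 * (sitePercolation (Site 2) q).real E5 := by gcongr
        _ ≤ (sitePercolation (Site 2) q).real (E1 ∩ E2 ∩ E3) * (sitePercolation (Site 2) q).real E4 *
            (sitePercolation (Site 2) q).real E5 := by gcongr
        _ ≤ (sitePercolation (Site 2) q).real (E1 ∩ E2 ∩ E3 ∩ E4) * (sitePercolation (Site 2) q).real E5 := by gcongr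
        _ ≤ _ := h12345

/-! ### The exit runs on the two base sides -/

/-- The transposed connector of the right side is a connector of the top side. [folklore] -/
theorem swap_vConn {r e s n j : ℕ} (hns : n * s = r) (hj : j + 2 ≤ n) :
    (vConn r (-(r : ℤ)) e s j).swap = hConn 0 r e s (n - 2 - j) := by
  have hcast : ((n - 2 - j : ℕ) : ℤ) = n - 2 - j := by omega
  have hns' : (n : ℤ) * s = r := by exact_mod_cast hns
  simp only [Tube.swap, vConn, hConn, Bool.not_true, Tube.mk.injEq, and_true]
  rw [hcast]; linarith

/-- The transposed piece of the right side is a piece of the top side. [folklore] -/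
theorem swap_vPiece {r e s n j : ℕ} (hns : n * s = r) (hj : j + 1 ≤ n) :
    (vPiece r (-(r : ℤ)) e s j).swap = hPiece 0 r e s (n - 1 - j) := by
  have hcast : ((n - 1 - j : ℕ) : ℤ) = n - 1 - j := by omega
  have hns' : (n : ℤ) * s = r := by exact_mod_cast hns
  simp only [Tube.swap, vPiece, hPiece, Bool.not_false, Tube.mk.injEq, and_true]
  rw [hcast]; linarith

/-- Odd positions of the third block of the half ring are the connectors `hConn` of the side `x₁ = r`. [folklore] -/
theorem halfTube_hside_add_one {r e s j : ℕ} (hj : j + 1 < r / s) : halfTube r e s (4 * (r / s) + 2 * j) = hConn 0 r e s j := by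
  unfold halfTube
  rw [if_neg (by omega), if_neg (by omega), show 4 * (r / s) + 2 * j - (4 * (r / s) - 1) = 2 * j + 1 by omega, if_neg (by omega),
    show (2 * j + 1) / 2 = j by omega]

/-- **The tubes of the transposed exit run of the top side, by position**: for
`T ∈ vchunks r (-r) e s x (d+1)` (`x + d < n = r / s`), `T.swap` is the ring tube at a position in
`[piecePos n 2 (x + d), piecePos n 2 x]`. [folklore] -/
theorem exists_pos_swap_of_mem_vchunks {r e s x d : ℕ} (hr : 1 ≤ r / s) (hns : r / s * s = r) (hxd : x + d < r / s) {T : Tube}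
    (hT : T ∈ vchunks r (-(r : ℤ)) e s x (d + 1)) :
    ∃ g, piecePos (r / s) 2 (x + d) ≤ g ∧ g ≤ piecePos (r / s) 2 x ∧ g < 12 * (r / s) - 4 ∧ ringTube r e s g = T.swap := by
  obtain ⟨i, h1, h2, h3⟩ := mem_vchunks (r : ℤ) (-(r : ℤ)) e s hT
  have hp : ∀ j, j < r / s → piecePos (r / s) 2 j = 6 * (r / s) - 3 - 2 * j := fun j hj => by
    unfold piecePos blockOff; simp only [show (2 : ℕ) % 3 = 2 from rfl, if_true]; omega
  rcases h3 with rfl | ⟨rfl, h4⟩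
  · refine ⟨piecePos (r / s) 2 i, ?_, ?_, ?_, ?_⟩
    · rw [hp i (by omega), hp (x + d) (by omega)]; omega
    · rw [hp i (by omega), hp x (by omega)]; omega
    · rw [hp i (by omega)]; omega
    · rw [swap_vPiece hns (by omega), hp i (by omega)]
      unfold ringTube
      rw [if_pos (by omega), show 6 * (r / s) - 3 - 2 * i = 4 * (r / s) - 1 + 2 * (r / s - 1 - i) by omega, halfTube_hside (by omega)]
  · refine ⟨piecePos (r / s) 2 i - 1, ?_, ?_, ?_, ?_⟩
    · rw [hp i (by omega), hp (x + d) (by omega)]; omega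
    · rw [hp i (by omega), hp x (by omega)]; omega
    · rw [hp i (by omega)]; omega
    · rw [swap_vConn hns (by omega), hp i (by omega)]
      unfold ringTube
      rw [if_pos (by omega), show 6 * (r / s) - 3 - 2 * i - 1 = 4 * (r / s) + 2 * (r / s - 2 - i) by omega, halfTube_hside_add_one (by omega)]

/-! ### The move -/

/-- Frames shifted by three read the reflected configuration: `frameConfig ((i+3) % 6) (frameConfig 3 χ) = frameConfig i χ` (`i < 6`). [folklore] -/
theorem frameConfig_add_three_three {i : ℕ} (hi : i < 6) (χ : SiteConfig (Site 2)) :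
    frameConfig ((i + 3) % 6) (frameConfig 3 χ) = frameConfig i χ := by
  ext v
  rw [mem_frameConfig, mem_frameConfig, mem_frameConfig, frameIso_add_three hi]
  change triNegIso (-(frameIso i v)) ∈ χ ↔ _
  rw [triNegIso_apply, neg_neg]

namespace Slot4

variable {P : OParams} {σ : Slot4}

/-- **The move of one arm.** For a valid rung, a slot in range with the routing predicate, on the arm
event and the corridor event of the arm `e` the reading configuration, read once more through the frame
of the base side, carries an open arm landed on the right side of `∂Λ_{4M}`:
`frameConfig (bs e) (psiCfg e ω) ∈ extOpenArm n (4M)`. [cite: Nolin2008, §4.3 Prop. 12 and §4.4 (arXiv 0711.4948: Prop. 11, Thm. 10, p. 12)] -/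
theorem move_one (hV : P.Valid) (hσ : σ.InRange P) (hR : RouteOK P σ) (e : Fin 4) {ω : SiteConfig (Site 2)}
    (hA : ω ∈ σ.armE P e) (hC : ω ∈ σ.corrE P e) : frameConfig (bs e) (psiCfg e ω) ∈ extOpenArm P.n (4 * P.M) := by
  obtain ⟨hs, hk₀, hμ, hw1, hw2, he1, he2, hε1, hε2, -, -, -, -, -, -, hN, -, -, hn, hμM, hR₀, hR₀M, -⟩ := hV.ifacts
  obtain ⟨ke1, ke2, re1, re2, nse', rW, re5, Le, ne1, nse, Ge, dve, ⟨te1, te2⟩, hμe, hμe'⟩ := arm_facts hV hσ e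
  have hN4 : P.N' = 4 * P.M := hV.facts.2.2.2.2.2.2.2.2.2.2.2.2.1
  have hs1 : 1 ≤ P.s := by omega
  have hfr := hσ.hfr e
  have hfr' := fr'_lt hσ e
  obtain ⟨F, hmid, hj, hw1', hw2'⟩ := hA
  -- the arm, in the reading configuration
  have hk : F.k = σ.k P e := by show trapScale P.k₀ F.j = trapScale P.k₀ (σ.sc e); rw [hj]
  have hcfg : frameConfig (σ.fr' e) (psiCfg e ω) = frameConfig (σ.fr e) (colCfg (col e) ω) := by
    unfold psiCfg Slot4.fr'
    by_cases h2 : 2 ≤ (e : ℕ)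
    · rw [if_pos h2, if_pos h2]; exact frameConfig_add_three_three hfr _
    · rw [if_neg h2, if_neg h2]
  set F' : TrapFencedArm P.M P.n P.k₀ P.K (frameConfig (σ.fr' e) (psiCfg e ω)) := F.transport hcfg.symm with hF'
  have hk' : F'.k = σ.k P e := (TrapFencedArm.transport_k _ _).trans hk
  have hz' : F'.z = F.z := TrapFencedArm.transport_z _ _
  -- the corridor
  obtain ⟨⟨⟨⟨hB, hSp⟩, harc⟩, hH⟩, hVt⟩ := hC
  -- the entry piece
  set ι := latIdx P.s (σ.r P e) (σ.ξ P e) with hι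
  have hξr : -(σ.r P e : ℤ) ≤ σ.ξ P e := by unfold Slot4.ξ; omega
  have hιn : ι + 2 < σ.nr P e := latIdx_add_lt (m := 2) hs1 nse' hξr (by unfold Slot4.ξ; push_cast; omega)
  have hspec := latIdx_spec (s := P.s) (r := σ.r P e) hs1 hξr
  rw [← hι] at hspec
  have hnsn : σ.nr P e * P.s = σ.r P e := by exact_mod_cast nse'
  have hJ : SpokeMeets (σ.fr' e) (ospokeTube P.M F'.k (σ.T P e) P.w (σ.L P e) P.ε) (pieceTube (σ.r P e) P.e P.s (σ.nr P e) (σ.fr' e) ι) := by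
    rw [hk']
    refine ospokeMeets_pieceTube hfr' hnsn (by omega) ?_ (by omega) (by rw [Le]; omega) (by omega)
    unfold Slot4.ξ at hspec; exact hspec
  have hGe : σ.G P e = 12 * (σ.r P e / P.s) - 4 := by rw [Ge, nse]
  obtain ⟨hast, haln1, haln⟩ := hR.1 e
  have hTe : pieceTube (σ.r P e) P.e P.s (σ.nr P e) (σ.fr' e) ι ∈ arc (thinRing (σ.r P e) P.e P.s) (σ.ast e) (σ.aln e) := by
    have hin := hR.2.2.1 e
    unfold Slot4.pE at hin
    rw [← hι, hGe] at hin
    rw [nse, ← ringTube_piecePos (nse ▸ ne1) hfr' (by rw [← nse]; omega)]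
    exact ringTube_mem_arc_of_inArc (nse ▸ ne1) (by rw [← hGe]; exact hast) (by rw [← nse]; exact piecePos_lt ne1 hfr' (by omega)) hin
  -- the exit run
  have hx := latIdx_spec (s := P.s) (r := σ.r P e) hs1 (show -(σ.r P e : ℤ) ≤ σ.t P e by omega)
  obtain ⟨hd1, hd2⟩ := P.d_mul_facts hs1
  have hd1' : ((P.d + 1 : ℕ) : ℤ) * P.s ≤ (P.N' / 64 : ℕ) + 4 * P.s := by exact_mod_cast hd1
  have hd2' : ((P.N' / 64 : ℕ) : ℤ) + 2 * P.s ≤ (P.d : ℤ) * P.s := by exact_mod_cast hd2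
  have hN64 : ((P.N' / 64 : ℕ) : ℤ) ≤ P.M / 16 + 1 := by rw [hN4]; push_cast; omega
  have hN64' : ((P.N' / 64 : ℕ) : ℤ) = (4 * P.M / 64 : ℕ) := by rw [hN4]
  have hxd : σ.x P e + P.d < σ.nr P e := by
    have h := latIdx_add_lt (s := P.s) (r := σ.r P e) (n := σ.nr P e) (m := P.d + 1) hs1 nse' (show -(σ.r P e : ℤ) ≤ σ.t P e by omega)
      (by have h5 : ((P.N' / 64 : ℕ) : ℤ) + 4 * P.s < P.M + (4 * P.M / 16 : ℕ) := by omega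
          linarith [te2, hd1', h5])
    unfold Slot4.x; omega
  have hrun_in : ∀ g, σ.runLo P e ≤ g → g ≤ σ.runHi P e → g < σ.G P e → ringTube (σ.r P e) P.e P.s g ∈ arc (thinRing (σ.r P e) P.e P.s) (σ.ast e) (σ.aln e) :=
    fun g h1 h2 h3 => by
      have hin := hR.2.2.2.1 e g h3 h1 h2
      rw [hGe] at hin h3
      exact ringTube_mem_arc_of_inArc (nse ▸ ne1) (by rw [← hGe]; exact hast) h3 hin
  have hlo : -(σ.r P e : ℤ) + σ.x P e * P.s - P.e ≤ σ.t P e := by unfold Slot4.x; linarith [hx.1]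
  have hhi : σ.t P e + (4 * P.M / 64 : ℕ) ≤ -(σ.r P e : ℤ) + (σ.x P e + P.d) * P.s - P.e := by
    have hxds : ((σ.x P e : ℕ) + (P.d : ℕ) : ℤ) * P.s = (σ.x P e : ℤ) * P.s + (P.d : ℤ) * P.s := by ring
    rw [← hN64', hxds]
    unfold Slot4.x at hxds ⊢
    linarith [hx.2]
  have hWe : (σ.r P e : ℤ) - 2 * P.e + σ.W P e = 4 * P.M + (4 * P.M / 16 : ℕ) := by rw [rW, hN4]; push_cast; ring
  -- the sides
  have hbs : bs e = 0 ∨ bs e = 2 := by unfold bs; split_ifs <;> simp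
  rcases hbs with hb0 | hb2
  · -- right side
    rw [hb0, frameConfig_zero]
    rw [hb0] at hH hVt
    simp only [Set.mem_setOf_eq, frameConfig_zero] at hH hVt
    have hSL : ∀ T ∈ vchunks (σ.r P e) (-(σ.r P e : ℤ)) P.e P.s (σ.x P e) (P.d + 1), T ∈ arc (thinRing (σ.r P e) P.e P.s) (σ.ast e) (σ.aln e) := by
      intro T hT
      obtain ⟨g, hg1, hg2, rfl⟩ := exists_pos_of_mem_vchunks (by rw [← nse]; exact hxd) hT
      have hp0 : ∀ j, piecePos (σ.nr P e) 0 j = 2 * j := fun j => by unfold piecePos blockOff; simp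
      have hrl : σ.runLo P e = 2 * σ.x P e ∧ σ.runHi P e = 2 * (σ.x P e + P.d) := by
        unfold Slot4.runLo Slot4.runHi; rw [hb0, hp0, hp0]; constructor <;> omega
      exact hrun_in g (by omega) (by omega) (by rw [Ge]; omega)
    exact out_landing_move_row hV.hn hfr' F' (by rw [hz']; exact hmid) (by rw [hk']; omega) (T₀ := σ.T P e) (w := P.w)
      (by rw [hk']; omega) (by rw [hk']; omega) (by rw [hz']; exact ⟨hw1', hw2'⟩) (by rw [hk']; exact hB) (L := σ.L P e) (ε := P.ε)
      (by rw [hk']; omega) (by rw [hk']; zify; rw [Le]; omega) (by rw [hk']; exact hSp) hs1 dve (by zify; omega) (by zify; omega) harc hTe hJ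
      ⟨te1, te2⟩ hSL hlo hhi hWe hH hVt (by omega) (by rw [hk', Le]; omega) (by omega) (by omega)
  · -- top side
    rw [hb2]
    rw [hb2] at hH hVt
    simp only [Set.mem_setOf_eq] at hH hVt
    have hSL : ∀ T ∈ vchunks (σ.r P e) (-(σ.r P e : ℤ)) P.e P.s (σ.x P e) (P.d + 1), T.swap ∈ arc (thinRing (σ.r P e) P.e P.s) (σ.ast e) (σ.aln e) := by
      intro T hT
      obtain ⟨g, hg1, hg2, hg3, hgT⟩ := exists_pos_swap_of_mem_vchunks (nse ▸ ne1) (by rw [← nse]; exact hnsn) (by rw [← nse]; exact hxd) hT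
      rw [← hgT]
      have hrl : σ.runLo P e = piecePos (σ.r P e / P.s) 2 (σ.x P e + P.d) ∧ σ.runHi P e = piecePos (σ.r P e / P.s) 2 (σ.x P e) := by
        unfold Slot4.runLo Slot4.runHi; rw [hb2, nse]
        have hp : ∀ j, j < σ.r P e / P.s → piecePos (σ.r P e / P.s) 2 j = 6 * (σ.r P e / P.s) - 3 - 2 * j := fun j hj => by
          unfold piecePos blockOff; simp only [show (2 : ℕ) % 3 = 2 from rfl, if_true]; omega
        rw [hp _ (by rw [← nse]; omega), hp _ (by rw [← nse]; omega)]
        constructor <;> simp only [min_def, max_def] <;> split_ifs <;> omega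
      exact hrun_in g (by omega) (by omega) (by rw [hGe]; exact hg3)
    exact out_landing_move_two hV.hn hfr' F' (by rw [hz']; exact hmid) (by rw [hk']; omega) (T₀ := σ.T P e) (w := P.w)
      (by rw [hk']; omega) (by rw [hk']; omega) (by rw [hz']; exact ⟨hw1', hw2'⟩) (by rw [hk']; exact hB) (L := σ.L P e) (ε := P.ε)
      (by rw [hk']; omega) (by rw [hk']; zify; rw [Le]; omega) (by rw [hk']; exact hSp) hs1 dve (by zify; omega) (by zify; omega) harc hTe hJ
      ⟨te1, te2⟩ hSL hlo hhi hWe hH hVt (by omega) (by rw [hk', Le]; omega) (by omega) (by omega)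

/-- **The move.** On the four arm events and the four corridor events of a routed slot in range, the
configuration has four alternating arms landed on the sides `0, 2, 3, 5` of `∂Λ_{4M}`:
`(⋂ₑ armE e) ∩ (⋂ₑ corrE e) ⊆ extFourArmQ n (4M)`. [cite: Nolin2008, §4.3 Prop. 12 and §4.4 (arXiv 0711.4948: Prop. 11, Thm. 10, p. 12)] -/
theorem move (hV : P.Valid) (hσ : σ.InRange P) (hR : RouteOK P σ) {ω : SiteConfig (Site 2)}
    (hA : ∀ e, ω ∈ σ.armE P e) (hC : ∀ e, ω ∈ σ.corrE P e) : ω ∈ extFourArmQ P.n (4 * P.M) := by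
  have h0 := move_one hV hσ hR 0 (hA 0) (hC 0)
  have h1 := move_one hV hσ hR 1 (hA 1) (hC 1)
  have h2 := move_one hV hσ hR 2 (hA 2) (hC 2)
  have h3 := move_one hV hσ hR 3 (hA 3) (hC 3)
  have e0 : frameConfig (bs 0) (psiCfg 0 ω) = ω := by
    unfold bs psiCfg col; simp [frameConfig_zero]
  have e1 : frameConfig (bs 1) (psiCfg 1 ω) = frameConfig 2 ωᶜ := by
    unfold bs psiCfg col; simp
  have e2 : frameConfig (bs 2) (psiCfg 2 ω) = frameConfig 3 ω := by
    unfold bs psiCfg col; simp [frameConfig_zero]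
  have e3 : frameConfig (bs 3) (psiCfg 3 ω) = frameConfig 5 ωᶜ := by
    unfold bs psiCfg col; simp [frameConfig_two_three]
  rw [e0] at h0; rw [e1] at h1; rw [e2] at h2; rw [e3] at h3
  exact ⟨h0, h1, h2, h3⟩

end Slot4

/-! ### Harris for two decreasing events -/

/-- **Harris–FKG for two DECREASING local events at density `q`** (by colour exchange from the
increasing case at `1 - q`). [cite: KestenPTM1982, §4.1 (Harris–FKG)] -/
theorem triSitePercolation_harris_lower (q : unitInterval) {A B : Set (SiteConfig (Site 2))} {F G : Finset (Site 2)}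
    (hAF : DeterminedBy A ↑F) (hBG : DeterminedBy B ↑G) (hA : IsLowerSet A) (hB : IsLowerSet B) :
    (triSitePercolation q).real A * (triSitePercolation q).real B ≤ (triSitePercolation q).real (A ∩ B) := by
  set A' : Set (SiteConfig (Site 2)) := {ω | ωᶜ ∈ A} with hA'
  set B' : Set (SiteConfig (Site 2)) := {ω | ωᶜ ∈ B} with hB'
  have hA'F : DeterminedBy A' ↑F := DeterminedBy.preimage_compl' hAF
  have hB'G : DeterminedBy B' ↑G := DeterminedBy.preimage_compl' hBG
  have uA : IsUpperSet A' := fun ω ω' hle h => hA (Set.compl_subset_compl.2 hle) h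
  have uB : IsUpperSet B' := fun ω ω' hle h => hB (Set.compl_subset_compl.2 hle) h
  have eA : A = compl ⁻¹' A' := by ext ω; simp [hA']
  have eB : B = compl ⁻¹' B' := by ext ω; simp [hB']
  have eAB : A ∩ B = compl ⁻¹' (A' ∩ B') := by rw [eA, eB]; rfl
  have h := sitePercolation_harris' (V := Site 2) (unitInterval.symm q) hA'F hB'G uA uB
  have e1 : (sitePercolation (Site 2) q).real A = (sitePercolation (Site 2) (unitInterval.symm q)).real A' := by
    rw [eA]; exact sitePercolation_real_preimage_compl q A'
  have e2 : (sitePercolation (Site 2) q).real B = (sitePercolation (Site 2) (unitInterval.symm q)).real B' := by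
    rw [eB]; exact sitePercolation_real_preimage_compl q B'
  have e3 : (sitePercolation (Site 2) q).real (A ∩ B) = (sitePercolation (Site 2) (unitInterval.symm q)).real (A' ∩ B') := by
    rw [eAB]; exact sitePercolation_real_preimage_compl q _
  unfold triSitePercolation
  rw [e1, e2, e3]
  exact h

namespace OParams

/-- The rings have at most as many chunks as the outermost one (`ℓ < 8`). [folklore] -/
theorem Valid.nL_le_nL_seven {P : OParams} (hV : P.Valid) {ℓ : ℕ} (hℓ : ℓ < 8) : P.nL ℓ ≤ P.nL 7 := by
  obtain ⟨-, h2, h3, -⟩ := hV.ring_facts hℓ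
  obtain ⟨g1, -, g3, -⟩ := hV.ring_facts (show 7 < 8 by norm_num)
  have hs : 0 < P.s := by have := hV.facts.1; have := hV.facts.2.2.2.2.1; omega
  have hμ : (2 * ℓ + 1) * P.μ ≤ (2 * 7 + 1) * P.μ := Nat.mul_le_mul_right _ (by omega)
  have hlt : P.nL ℓ * P.s < (P.nL 7 + 1) * P.s := by rw [add_mul, one_mul, h3, g3]; omega
  have := Nat.lt_of_mul_lt_mul_right hlt
  omega

end OParams

namespace Slot4

variable {P : OParams} {σ : Slot4}

/-- Colours of the four arms. [folklore] -/
theorem col_vals : col 0 = true ∧ col 1 = false ∧ col 2 = true ∧ col 3 = false := by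
  refine ⟨?_, ?_, ?_, ?_⟩ <;> rfl

/-- The intersection of the four arm events, grouped by colour. [folklore] -/
theorem iInter_armE_eq (P : OParams) (σ : Slot4) :
    (⋂ e, σ.armE P e) = (σ.armE P 0 ∩ σ.armE P 2) ∩ (σ.armE P 1 ∩ σ.armE P 3) := by
  ext ω
  simp only [Set.mem_iInter, Set.mem_inter_iff]
  constructor
  · intro h; exact ⟨⟨h 0, h 2⟩, h 1, h 3⟩
  · rintro ⟨⟨h0, h2⟩, h1, h3⟩ e
    fin_cases e <;> assumption

/-- **The corridor of the arm `e` has probability at least `c_F c^(B+3)` at density `p`** (through the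
reading map: at `p` for the open arms, at `1 - p` for the closed ones). [cite: Nolin2008, §4.3 Prop. 12 (proof) (arXiv 0711.4948: Prop. 11)] -/
theorem real_corrE_ge (hV : P.Valid) (hσ : σ.InRange P) (hR : RouteOK P σ) (p : unitInterval) {cF c : ℝ} {ρ Ncap B : ℕ}
    (hF : ∀ q : unitInterval, (q = p ∨ q = unitInterval.symm p) →
      ∀ (z : Site 2) (k : ℕ), 1 ≤ k → k ≤ Ncap → cF ≤ (triSitePercolation q).real (triFrameAt z k))
    (hrsw : ∀ q : unitInterval, (q = p ∨ q = unitInterval.symm p) →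
      ∀ n : ℕ, 1 ≤ ⌊(ρ : ℝ) * n⌋₊ → n ≤ Ncap → c ≤ triLRCrossingProb q ⌊(ρ : ℝ) * n⌋₊ n)
    (hρ : 64 ≤ ρ) (hc : 0 ≤ c) (hsp : P.LL 7 + P.μ ≤ ρ * (2 * P.ε)) (hcap : P.N' / 16 ≤ Ncap) (hB : P.Gr 7 ≤ B) (e : Fin 4) :
    cF * c ^ (B + 3) ≤ (triSitePercolation p).real (σ.corrE P e) := by
  obtain ⟨hs, hk₀, hμ, hw1, hw2, he1, he2, hε1, hε2, -, -, -, -, -, -, hN, -, -, hn, hμM, hR₀, hR₀M, -⟩ := hV.ifacts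
  obtain ⟨ke1, ke2, re1, re2, nse', rW, re5, Le, ne1, nse, Ge, dve, ⟨te1, te2⟩, hμe, hμe'⟩ := arm_facts hV hσ e
  have hN4 : P.N' = 4 * P.M := hV.facts.2.2.2.2.2.2.2.2.2.2.2.2.1
  obtain ⟨hast, haln1, haln⟩ := hR.1 e
  have hLL7 : (P.LL 7 : ℤ) = 15 * P.μ + 2 * P.s + 4 * P.e := by unfold OParams.LL; push_cast; ring
  have hsp' : (P.LL 7 : ℤ) + P.μ ≤ ρ * (2 * P.ε) := by exact_mod_cast hsp
  unfold corrE
  rw [show {ω | psiCfg e ω ∈ ocorrEvent4 (σ.fr' e) P.M (σ.k P e) (σ.T P e) P.w (σ.L P e) P.ε (σ.r P e) P.e P.s (σ.ast e) (σ.aln e)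
      (bs e) (σ.t P e) (σ.W P e) P.N'} = {ω | psiCfg e ω ∈ ocorrEvent4 (σ.fr' e) P.M (σ.k P e) (σ.T P e) P.w (σ.L P e) P.ε (σ.r P e)
      P.e P.s (σ.ast e) (σ.aln e) (bs e) (σ.t P e) (σ.W P e) P.N'} from rfl, real_preimage_psiCfg]
  set q : unitInterval := if col e then p else unitInterval.symm p with hq
  have hq' : q = p ∨ q = unitInterval.symm p := by rw [hq]; split_ifs <;> simp
  have hlen : (arc (thinRing (σ.r P e) P.e P.s) (σ.ast e) (σ.aln e)).length ≤ B := by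
    rw [length_arc (by rw [length_thinRing (nse ▸ ne1), ← nse, ← Ge]; exact haln)]
    have h7 := hV.nL_le_nL_seven (hσ.hlv e)
    have : σ.G P e ≤ P.Gr 7 := by rw [Ge]; unfold OParams.Gr Slot4.nr at *; omega
    omega
  refine real_ocorrEvent4_ge_at q (hF q hq') (hrsw q hq') (by omega) hc (k := σ.k P e) (by omega) ?_ ?_ ?_ ?_ ?_ ?_ ?_ (nse ▸ ne1)
    ?_ ?_ ?_ ?_ ?_ ?_ hlen
  · have : σ.k P e / 2 ≤ P.N' / 16 := by omega
    omega
  · omega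
  · omega
  · zify; rw [Le]; omega
  · omega
  · omega
  · omega
  · omega
  · omega
  · have hW : (σ.W P e : ℤ) ≤ 2 * P.M + (P.N' / 16 : ℕ) + 2 * P.e := by omega
    have h64 : (P.N' : ℤ) ≤ 64 * ((P.N' / 64 : ℕ) : ℤ) + 63 := by omega
    have hN16 : ((P.N' / 16 : ℕ) : ℤ) ≤ P.M / 4 + 1 := by rw [hN4]; push_cast; omega
    have h1 : σ.W P e ≤ 64 * (P.N' / 64) := by zify; omega
    exact h1.trans (Nat.mul_le_mul_right _ hρ)
  · have hρ' : 2 ≤ ρ := by omega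
    calc 2 * (P.N' / 64) ≤ 2 * (P.N' / 16 - 1) := by omega
      _ ≤ ρ * (P.N' / 16 - 1) := Nat.mul_le_mul_right _ hρ'
  · omega
  · omega

/-- **Nolin's Lemma 13 for a routed slot**: `P_p(⋂ₑ armE e) · (c_F c^(B+3))⁴ ≤ P_p(extFourArmQ n (4M))` —
the generalised FKG inequality (`triSitePercolation_locallyMonotone_fkg`) with the shared support
`osharedFin n M`, the private support `privE 0 ∪ privE 2` of the increasing events (the two open arms
and their corridors) and `privE 1 ∪ privE 3` of the decreasing ones, pairwise disjoint for a routed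
slot holding the four arms (`ArmSeparationOutSepFour.lean`), the corridor bounds and the move. [cite: Nolin2008, §4.3 Prop. 12 and Lemma 13 (arXiv 0711.4948: Prop. 11, Lemma 12); §4.4 p. 12 (constants C₁, C₂)] -/
theorem real_arms_le (hV : P.Valid) (hσ : σ.InRange P) (hR : RouteOK P σ) (p : unitInterval) {cF c : ℝ} {ρ Ncap B : ℕ}
    (hF : ∀ q : unitInterval, (q = p ∨ q = unitInterval.symm p) →
      ∀ (z : Site 2) (k : ℕ), 1 ≤ k → k ≤ Ncap → cF ≤ (triSitePercolation q).real (triFrameAt z k))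
    (hrsw : ∀ q : unitInterval, (q = p ∨ q = unitInterval.symm p) →
      ∀ n : ℕ, 1 ≤ ⌊(ρ : ℝ) * n⌋₊ → n ≤ Ncap → c ≤ triLRCrossingProb q ⌊(ρ : ℝ) * n⌋₊ n)
    (hρ : 64 ≤ ρ) (hc : 0 ≤ c) (hcF : 0 ≤ cF) (hsp : P.LL 7 + P.μ ≤ ρ * (2 * P.ε)) (hcap : P.N' / 16 ≤ Ncap) (hB : P.Gr 7 ≤ B) :
    (triSitePercolation p).real (⋂ e, σ.armE P e) * (cF * c ^ (B + 3)) ^ 4 ≤ (triSitePercolation p).real (extFourArmQ P.n (4 * P.M)) := by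
  classical
  by_cases hne : (⋂ e, σ.armE P e).Nonempty
  swap
  · rw [Set.not_nonempty_iff_eq_empty.1 hne, measureReal_empty, zero_mul]; exact measureReal_nonneg
  obtain ⟨ω₀, hω₀⟩ := hne
  rw [Set.mem_iInter] at hω₀
  have hadm : σ.Adm P := fun e => adm_of_mem (hω₀ e)
  have hk2 : 2 ≤ P.k₀ := le_trans (by norm_num) hV.hk₀
  obtain ⟨c0, c1, c2, c3⟩ := col_vals
  -- the three pairwise disjoint regions of Nolin's Lemma 13
  have dS : ∀ e, Disjoint (osharedFin P.n P.M) (σ.privE P e) := fun e => disjoint_osharedFin_privE hV hσ hadm hR e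
  have hSP : Disjoint (osharedFin P.n P.M) (σ.privE P 0 ∪ σ.privE P 2) := Finset.disjoint_union_right.2 ⟨dS 0, dS 2⟩
  have hSM : Disjoint (osharedFin P.n P.M) (σ.privE P 1 ∪ σ.privE P 3) := Finset.disjoint_union_right.2 ⟨dS 1, dS 3⟩
  have hPM : Disjoint (σ.privE P 0 ∪ σ.privE P 2) (σ.privE P 1 ∪ σ.privE P 3) := by
    rw [Finset.disjoint_union_left, Finset.disjoint_union_right, Finset.disjoint_union_right]
    exact ⟨⟨disjoint_privE hV hσ hadm hR (by rw [c0, c1]; decide), disjoint_privE hV hσ hadm hR (by rw [c0, c3]; decide)⟩,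
      disjoint_privE hV hσ hadm hR (by rw [c2, c1]; decide), disjoint_privE hV hσ hadm hR (by rw [c2, c3]; decide)⟩
  -- supports of the arm events
  have dA : ∀ e, DeterminedBy (σ.armE P e) ((↑(osharedFin P.n P.M) : Set (Site 2)) ∪ ↑(σ.privE P e)) := fun e =>
    (determinedBy_armE hV (hσ.hfr e)).mono (Set.union_subset_union_right _ (image_oslotFrame_subset_privE (hσ.hfr e)))
  have dAp : DeterminedBy (σ.armE P 0 ∩ σ.armE P 2) (↑(osharedFin P.n P.M) ∪ ↑(σ.privE P 0 ∪ σ.privE P 2)) := by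
    rw [Finset.coe_union]
    exact ((dA 0).mono fun v hv => hv.elim (fun h => Or.inl h) fun h => Or.inr (Or.inl h)).inter
      ((dA 2).mono fun v hv => hv.elim (fun h => Or.inl h) fun h => Or.inr (Or.inr h))
  have dAm : DeterminedBy (σ.armE P 1 ∩ σ.armE P 3) (↑(osharedFin P.n P.M) ∪ ↑(σ.privE P 1 ∪ σ.privE P 3)) := by
    rw [Finset.coe_union]
    exact ((dA 1).mono fun v hv => hv.elim (fun h => Or.inl h) fun h => Or.inr (Or.inl h)).inter
      ((dA 3).mono fun v hv => hv.elim (fun h => Or.inl h) fun h => Or.inr (Or.inr h))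
  have dC : ∀ e, DeterminedBy (σ.corrE P e) ↑(σ.privE P e) := fun e => determinedBy_corrE hk2 e
  have dBp : DeterminedBy (σ.corrE P 0 ∩ σ.corrE P 2) ↑(σ.privE P 0 ∪ σ.privE P 2) := by
    rw [Finset.coe_union]; exact ((dC 0).mono subset_union_left).inter ((dC 2).mono subset_union_right)
  have dBm : DeterminedBy (σ.corrE P 1 ∩ σ.corrE P 3) ↑(σ.privE P 1 ∪ σ.privE P 3) := by
    rw [Finset.coe_union]; exact ((dC 1).mono subset_union_left).inter ((dC 3).mono subset_union_right)
  -- monotonicity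
  have uAp : IsUpperSet (σ.armE P 0 ∩ σ.armE P 2) := (isUpperSet_armE P σ c0).inter (isUpperSet_armE P σ c2)
  have lAm : IsLowerSet (σ.armE P 1 ∩ σ.armE P 3) := (isLowerSet_armE P σ c1).inter (isLowerSet_armE P σ c3)
  have uBp : IsUpperSet (σ.corrE P 0 ∩ σ.corrE P 2) := (isUpperSet_corrE P σ c0).inter (isUpperSet_corrE P σ c2)
  have lBm : IsLowerSet (σ.corrE P 1 ∩ σ.corrE P 3) := (isLowerSet_corrE P σ c1).inter (isLowerSet_corrE P σ c3)
  have fkg := triSitePercolation_locallyMonotone_fkg p hSP hSM hPM uAp lAm uBp lBm dAp dAm dBp dBm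
  -- the corridor probabilities
  have hC := real_corrE_ge hV hσ hR p hF hrsw hρ hc hsp hcap hB
  have hq : 0 ≤ cF * c ^ (B + 3) := by positivity
  have hBp : (cF * c ^ (B + 3)) ^ 2 ≤ (triSitePercolation p).real (σ.corrE P 0 ∩ σ.corrE P 2) := by
    have h := sitePercolation_harris' p (dC 0) (dC 2) (isUpperSet_corrE P σ c0) (isUpperSet_corrE P σ c2)
    unfold triSitePercolation at hC ⊢
    calc (cF * c ^ (B + 3)) ^ 2 = (cF * c ^ (B + 3)) * (cF * c ^ (B + 3)) := sq _
      _ ≤ (sitePercolation (Site 2) p).real (σ.corrE P 0) * (sitePercolation (Site 2) p).real (σ.corrE P 2) :=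
          mul_le_mul (hC 0) (hC 2) hq measureReal_nonneg
      _ ≤ _ := h
  have hBm : (cF * c ^ (B + 3)) ^ 2 ≤ (triSitePercolation p).real (σ.corrE P 1 ∩ σ.corrE P 3) := by
    have h := triSitePercolation_harris_lower p (dC 1) (dC 3) (isLowerSet_corrE P σ c1) (isLowerSet_corrE P σ c3)
    calc (cF * c ^ (B + 3)) ^ 2 = (cF * c ^ (B + 3)) * (cF * c ^ (B + 3)) := sq _
      _ ≤ (triSitePercolation p).real (σ.corrE P 1) * (triSitePercolation p).real (σ.corrE P 3) := mul_le_mul (hC 1) (hC 3) hq measureReal_nonneg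
      _ ≤ _ := h
  -- the move
  have hmove : (σ.armE P 0 ∩ σ.armE P 2) ∩ (σ.armE P 1 ∩ σ.armE P 3) ∩ ((σ.corrE P 0 ∩ σ.corrE P 2) ∩ (σ.corrE P 1 ∩ σ.corrE P 3)) ⊆
      extFourArmQ P.n (4 * P.M) := by
    rintro ω ⟨⟨⟨a0, a2⟩, a1, a3⟩, ⟨b0, b2⟩, b1, b3⟩
    refine move hV hσ hR (fun e => ?_) (fun e => ?_) <;> fin_cases e <;> assumption
  rw [iInter_armE_eq]
  calc (triSitePercolation p).real ((σ.armE P 0 ∩ σ.armE P 2) ∩ (σ.armE P 1 ∩ σ.armE P 3)) * (cF * c ^ (B + 3)) ^ 4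
      = (triSitePercolation p).real ((σ.armE P 0 ∩ σ.armE P 2) ∩ (σ.armE P 1 ∩ σ.armE P 3)) * ((cF * c ^ (B + 3)) ^ 2 * (cF * c ^ (B + 3)) ^ 2) := by ring
    _ ≤ (triSitePercolation p).real ((σ.armE P 0 ∩ σ.armE P 2) ∩ (σ.armE P 1 ∩ σ.armE P 3)) *
          ((triSitePercolation p).real (σ.corrE P 0 ∩ σ.corrE P 2) * (triSitePercolation p).real (σ.corrE P 1 ∩ σ.corrE P 3)) :=
        mul_le_mul_of_nonneg_left (mul_le_mul hBp hBm (by positivity) measureReal_nonneg) measureReal_nonneg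
    _ ≤ (triSitePercolation p).real ((σ.armE P 0 ∩ σ.armE P 2) ∩ (σ.armE P 1 ∩ σ.armE P 3) ∩
          ((σ.corrE P 0 ∩ σ.corrE P 2) ∩ (σ.corrE P 1 ∩ σ.corrE P 3))) := fkg
    _ ≤ (triSitePercolation p).real (extFourArmQ P.n (4 * P.M)) := measureReal_mono hmove (measure_ne_top _ _)

end Slot4

/-- **The sum over routed slots**: for any finite set `S` of slots in range satisfying the routing
predicate, `P_p(⋃_{σ ∈ S} ⋂ₑ armE σ e) · (c_F c^(B+3))⁴ ≤ #S · P_p(extFourArmQ n (4M))`. [cite: Nolin2008, §4.4 (arXiv 0711.4948: proof of Thm. 10, p. 12, "P(Ã^{·/η'}) ≤ C₁(η') P(Ã̃^{·/η',I_{η'}}) ≤ C₁ C₂ P(Ã̃^{·/η'₀,I_{η'₀}})")] -/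
theorem real_biUnion_arms_le {P : OParams} (hV : P.Valid) (p : unitInterval) {cF c : ℝ} {ρ Ncap B : ℕ}
    (hF : ∀ q : unitInterval, (q = p ∨ q = unitInterval.symm p) →
      ∀ (z : Site 2) (k : ℕ), 1 ≤ k → k ≤ Ncap → cF ≤ (triSitePercolation q).real (triFrameAt z k))
    (hrsw : ∀ q : unitInterval, (q = p ∨ q = unitInterval.symm p) →
      ∀ n : ℕ, 1 ≤ ⌊(ρ : ℝ) * n⌋₊ → n ≤ Ncap → c ≤ triLRCrossingProb q ⌊(ρ : ℝ) * n⌋₊ n)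
    (hρ : 64 ≤ ρ) (hc : 0 ≤ c) (hcF : 0 ≤ cF) (hsp : P.LL 7 + P.μ ≤ ρ * (2 * P.ε)) (hcap : P.N' / 16 ≤ Ncap) (hB : P.Gr 7 ≤ B)
    (S : Finset Slot4) (hS : ∀ σ ∈ S, σ.InRange P ∧ Slot4.RouteOK P σ) :
    (triSitePercolation p).real (⋃ σ ∈ S, ⋂ e, σ.armE P e) * (cF * c ^ (B + 3)) ^ 4 ≤
      S.card * (triSitePercolation p).real (extFourArmQ P.n (4 * P.M)) := by
  classical
  set q := (cF * c ^ (B + 3)) ^ 4 with hq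
  set E := (triSitePercolation p).real (extFourArmQ P.n (4 * P.M)) with hE
  have hq0 : 0 ≤ q := by positivity
  have hslot : ∀ σ ∈ S, (triSitePercolation p).real (⋂ e, σ.armE P e) * q ≤ E := fun σ hσ =>
    Slot4.real_arms_le hV (hS σ hσ).1 (hS σ hσ).2 p hF hrsw hρ hc hcF hsp hcap hB
  calc (triSitePercolation p).real (⋃ σ ∈ S, ⋂ e, σ.armE P e) * q
      ≤ (∑ σ ∈ S, (triSitePercolation p).real (⋂ e, σ.armE P e)) * q := mul_le_mul_of_nonneg_right (measureReal_biUnion_finset_le _ _) hq0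
    _ = ∑ σ ∈ S, (triSitePercolation p).real (⋂ e, σ.armE P e) * q := Finset.sum_mul _ _ _
    _ ≤ ∑ _σ ∈ S, E := Finset.sum_le_sum hslot
    _ = S.card * E := by rw [Finset.sum_const, nsmul_eq_mul]

end Literature.Probability.Percolation
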